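import Mathlib
import Summits.KontsevichZagierPeriods.Zeta5Search.FullProfileCellsA
import Summits.KontsevichZagierPeriods.Zeta5Search.FullProfileCellsB
import Summits.KontsevichZagierPeriods.Zeta5Search.DenomLaw.ShiftedL5Kit
import Summits.KontsevichZagierPeriods.Zeta5Search.LawA4Proof
import Summits.KontsevichZagierPeriods.Zeta5Search.DenomLaw.TS3RayPath
import HarnessLib

/-!
# ζ(5) search — PATH ACCOUNTING ON THE FULL PROFILE OF THE FIRST PERIOD FOR EVERY SORTED PARAMETER VECTOR (general `b`; THEOREM L5 / A⁗′ in the frame `(10, [1,−6,−6,1])`)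

Cell `pub-zeta5` (HONEST FRAMING: systematic search; no irrationality claim unless certified), TRACK «DENOM-LAW» D1 prover seat
(denom-prover-d1 g17, `HOME/denom-law/prover-d1/ATTEMPT-17.md` §B).  The node `DenomLaw.PathAccountingFirstPeriod` (Brown–Zudilin (28)+(30)
transported by `G ≅ S₇`, Casoratian form: `v_p(Cas₇(b)) ≥ ⌊d/p⌋ − N_p − min([⌊d/p⌋ ≥ 2], 5 − C⋆)`) quantifies over ALL sorted vectors `b` of the
polytope and all first-period primes; so far it is a theorem on rays and two-parameter families (record, flag, TOP_STAIR rays; the TOP / A-B / X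
families, gens 13–17).  THIS FILE proves it for EVERY sorted `b` on the FULL PROFILE of the first period — the primes `p` at which all 28 forms
`b_i`, `b₀ − b_i − b_k` lie in `[p, 2p)` (equivalently `p ≤ b₇` and `p ≤ b₀ − b₁ − b₂` inside the first period), i.e. the deep end of every
direction's first period, where `N_p = 21`, `C⋆ ≤ 11` and the node asks `⌊d/p⌋ − 15` — under the one restriction `d < 4p` (`⌊d/p⌋ ≤ 3`; the corner
`4p ≤ d < 5p` is left open, see below).  No ray, no family, no parameter count: ten free integers.
MECHANISM (gen 16's frame observation made a theorem): for every such `(b, p)` the residue classes mod `p` are typed level classes of one of 37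
explicit types per parity of `b₀` (`FullProfile.cover_ev / cover_od`, machine-generated COMPLETE decision trees over the place of each level among
the fourteen nested block ends, `FullProfileCells{A,B}`, kit `DenomLaw/SortedProfileLevels`), and both type lists satisfy the six clauses
`DenomLaw.checkL5` in the frame `(M, T) = (10, [1,−6,−6,1])` (`checkL5_ev`, `checkL5_od`, `decide`): the deep class is the centre-free palindrome
`[1,−6,−6,1]` (the two deepest well levels flanked by the outermost zero levels, exponent `−10`), the classes at `−9, −8, −7` its single / admissible
double / degree-3 raises.  Hence THEOREM A⁗′ (`SecondOrder.lawA4_holds`) gives `v_p(Cas_j(b)) ≥ 7 − 2M = −13` (`cas_ge_neg13`, every `j`) and, where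
`3p ≤ d` (degree condition `6p ≤ 2d + 1`), THEOREM L5 (`DenomLaw.cover_L5`) gives `−12` (`cas_ge_neg12`); with `N_p = 21`
(`SortedProfile.pairFloors_eq_21`) and `C⋆ ≤ 11` this is the node's value `⌊d/p⌋ − 15` for `⌊d/p⌋ ∈ {2, 3}` and more than it for `⌊d/p⌋ ≤ 1`:
**`pathAccounting_fullProfile`** (every `j`) and **`pathAccountingFirstPeriod_fullProfile`** (the node's binders verbatim plus `p ≤ b₇`,
`p + b₁ + b₂ ≤ b₀`, `d < 4p`).  EVIDENCE BESIDE THE PROOF (ATTEMPT-17 §B; `g17/code/fullprofile_*.py`): exhaustive `p ≤ 13` + 20,000 random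
large-`p` instances (86,497): the same 37 + 37 patterns, 0 exceptions; the OPEN corner `4p ≤ d`: exact valuations at `p ≤ 11` (325 instances) are
`−11` (323) / `−10` (2) = the node's value, one unit above L5 — an uncatalogued rung, recorded, not claimed.  MODEL/structure-side valuation
bookkeeping of the cell's own rationals; nothing about ζ(5); no γ; records in print UNMOVED.
-/

open Finset

namespace Summit.KontsevichZagierPeriods.Zeta5Search.FullProfile

open Summit.KontsevichZagierPeriods.Zeta5Search.ClusterValuation
open Summit.KontsevichZagierPeriods.Zeta5Search.CasoratianValuation (InPolytope shift casoratian pairFloors refund)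
open Summit.KontsevichZagierPeriods.Zeta5Search.WedgeDictionary (dOf)
open Summit.KontsevichZagierPeriods.Zeta5Search.ClassTypeCover
open Summit.KontsevichZagierPeriods.Zeta5Search.DenomLaw (cStar FirstPeriod Sorted7 checkL5 cover_L5 clausesL5_of_cover)
open Summit.KontsevichZagierPeriods.Zeta5Search.DenomLaw.FirstPeriodKit (cStar_le_eleven sorted7_chain)
open Summit.KontsevichZagierPeriods.Zeta5Search.RecordWindowsA4 (lawA4_apply)
open Summit.KontsevichZagierPeriods.Zeta5Search.SecondOrder (lawA4_holds)
open Summit.KontsevichZagierPeriods.Zeta5Search.StairTS3 (refund_le_pathHead)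
open Summit.KontsevichZagierPeriods.Zeta5Search.SortedProfile

/-! ## §1 The two type lists pass THEOREM L5's six clauses in the frame `(10, [1,−6,−6,1])` -/

/-- The six clauses of THEOREM L5 / A⁗′ (`DenomLaw.checkL5`) on the 37 full-profile types of an EVEN `b₀`, frame `(10, [1,−6,−6,1])`. -/
theorem checkL5_ev : checkL5 false
      [([1, -5, 1], true), ([1, -6, 1], false), ([1, 1, -6, 1], false), ([1, 0, -6, 1], false), ([1, -1, -6, 1], false), ([1, -2, -6, 1], false), ([1, -3, -6, 1], false), ([1, -4, -6, 1], false), ([1, -5, -6, 1], false), ([1, -5, -5, 1], false), ([1, -6, -6, 1], false), ([1, -6, -5, 1], false), ([1, -6, -4, 1], false), ([1, -6, -3, 1], false), ([1, -6, -2, 1], false), ([1, -6, -1, 1], false), ([1, -6, 0, 1], false), ([1, -6, 1, 1], false), ([1, 1, -5, 1, 1], true), ([1, 1, -6, -6, 1], false), ([1, 1, -6, -5, 1], false), ([1, 1, -6, -4, 1], false), ([1, 1, -6, -3, 1], false), ([1, 1, -6, -2, 1], false), ([1, 1, -6, -1, 1], false), ([1, 1, -6, 0, 1], false), ([1, 1,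 -6, 1, 1], false), ([1, 0, -5, 0, 1], true), ([1, 0, -6, 0, 1], false), ([1, 0, -6, 1, 1], false), ([1, -1, -6, 1, 1], false), ([1, -2, -6, 1, 1], false), ([1, -3, -6, 1, 1], false), ([1, -4, -6, 1, 1], false), ([1, -5, -6, 1, 1], false), ([1, -6, -6, 1, 1], false), ([1, 1, -6, -6, 1, 1], false)]
      10 [1, -6, -6, 1] = true := by decide

/-- The six clauses of THEOREM L5 / A⁗′ on the 37 full-profile types of an ODD `b₀`, frame `(10, [1,−6,−6,1])`. -/
theorem checkL5_od : checkL5 true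
      [([1, -6, 1], false), ([1, 1, -6, 1], false), ([1, 0, -6, 1], false), ([1, -1, -6, 1], false), ([1, -2, -6, 1], false), ([1, -3, -6, 1], false), ([1, -4, -6, 1], false), ([1, -5, -6, 1], false), ([1, -5, -5, 1], true), ([1, -5, -5, 1], false), ([1, -6, -6, 1], true), ([1, -6, -6, 1], false), ([1, -6, -5, 1], false), ([1, -6, -4, 1], false), ([1, -6, -3, 1], false), ([1, -6, -2, 1], false), ([1, -6, -1, 1], false), ([1, -6, 0, 1], false), ([1, -6, 1, 1], false), ([1, 1, -6, -6, 1], false), ([1, 1, -6, -5, 1], false), ([1, 1, -6, -4, 1], false), ([1, 1, -6, -3, 1], false), ([1, 1, -6, -2, 1], false), ([1, 1, -6, -1, 1], false), ([1, 1, -6, 0, 1], false), ([1, 1, -6, 1, 1], false), ([1, 0, -6, 0, 1], false), ([1, 0, -6, 1, 1], false), ([1, -1, -6, 1, 1], false), ([1, -2, -6, 1, 1], false), ([1, -3, -6, 1, 1], false), ([1, -4, -6, 1, 1], false), ([1, -5, -6, 1, 1], false), ([1, -6, -6, 1, 1], false), ([1, 1, -6, -6, 1, 1], true), ([1, 1,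 -6, -6, 1, 1], false)]
      10 [1, -6, -6, 1] = true := by decide

/-! ## §2 The valuation bounds on the full profile, every sorted `b`, every direction `j` -/

section Bounds

variable {b : ℕ → ℤ} {j p : ℕ}

/-- First-period and window facts used below: `b₁ < 2p`, `b₀ − b₆ − b₇ < 2p` (from `FirstPeriod`). -/
theorem fp_bounds (hfp : FirstPeriod b p) : b 1 < 2 * (p : ℤ) ∧ b 0 < 2 * (p : ℤ) + b 6 + b 7 := by
  have h1 := hfp.1 0 (by simp)
  have h2 := hfp.2 5 (by simp) 6 (by simp) (by norm_num)
  simp only [Nat.reduceAdd] at h1 h2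
  exact ⟨h1, by linarith⟩

/-- **THEOREM A⁗′ on the full profile, general `b`**: `v_p(Cas_j(b)) ≥ −13 = 7 − 2M` for every sorted `b` in the polytope, every admissible `j`, every
prime `5 ≤ p` with `b₀ + 2 < p²` at which all 28 forms lie in `[p, 2p)`. -/
theorem cas_ge_neg13 (hb : InPolytope b) (hs : Sorted7 b) (hbj : InPolytope (shift b j)) (hj1 : 1 ≤ j) (hj7 : j ≤ 7)
    (hprime : p.Prime) (hp5 : 5 ≤ p) (hwin : (b 0 + 2 : ℤ) < (p : ℤ) ^ 2) (hP : (p : ℤ) ≤ b 7) (hQ : (p : ℤ) + b 1 + b 2 ≤ b 0)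
    (hF1 : b 1 < 2 * (p : ℤ)) (hF2 : b 0 < 2 * (p : ℤ) + b 6 + b 7) (hcas : casoratian b j ≠ 0) :
    (-13 : ℤ) ≤ padicValRat p (casoratian b j) := by
  haveI : Fact p.Prime := ⟨hprime⟩
  have hp2 : p % 2 = 1 := Nat.odd_iff.1 (hprime.odd_of_ne_two (by omega))
  obtain ⟨h0, hb1, hb2, -, -, -, -, -, -⟩ := box hb
  have hpb : (p : ℤ) ≤ b 0 := by linarith
  have hT : ([1, -6, -6, 1] : List ℤ).reverse = [1, -6, -6, 1] := by decide
  rcases Int.emod_two_eq_zero_or_one (b 0) with hr | hr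
  · obtain ⟨hC, -⟩ := clausesL5_of_cover (cover_ev hb hs hP hQ hF1 hF2 hp5 hp2 hr) (M := 10) (T := [1, -6, -6, 1])
      (by rw [oddFlag_false hr]; exact checkL5_ev)
    have h := lawA4_apply lawA4_holds _ p j 10 [1, -6, -6, 1] hb hbj hj1 hj7 hprime hp5 hpb hwin (by norm_num) (by decide) hT hC hcas
    push_cast at h; linarith
  · obtain ⟨hC, -⟩ := clausesL5_of_cover (cover_od hb hs hP hQ hF1 hF2 hp5 hp2 hr) (M := 10) (T := [1, -6, -6, 1])
      (by rw [oddFlag_true hr]; exact checkL5_od)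
    have h := lawA4_apply lawA4_holds _ p j 10 [1, -6, -6, 1] hb hbj hj1 hj7 hprime hp5 hpb hwin (by norm_num) (by decide) hT hC hcas
    push_cast at h; linarith

/-- **THEOREM L5 on the full profile, general `b`**: `v_p(Cas_j(b)) ≥ −12 = 8 − 2M` when moreover `3p ≤ d(b)` (the degree condition `6p ≤ 2d + 1`). -/
theorem cas_ge_neg12 (hb : InPolytope b) (hs : Sorted7 b) (hbj : InPolytope (shift b j)) (hj1 : 1 ≤ j) (hj7 : j ≤ 7)
    (hprime : p.Prime) (hp5 : 5 ≤ p) (hwin : (b 0 + 2 : ℤ) < (p : ℤ) ^ 2) (hP : (p : ℤ) ≤ b 7) (hQ : (p : ℤ) + b 1 + b 2 ≤ b 0)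
    (hF1 : b 1 < 2 * (p : ℤ)) (hF2 : b 0 < 2 * (p : ℤ) + b 6 + b 7) (hd : 3 * (p : ℤ) ≤ dOf b) (hcas : casoratian b j ≠ 0) :
    (-12 : ℤ) ≤ padicValRat p (casoratian b j) := by
  haveI : Fact p.Prime := ⟨hprime⟩
  have hp2 : p % 2 = 1 := Nat.odd_iff.1 (hprime.odd_of_ne_two (by omega))
  obtain ⟨h0, hb1, hb2, -, -, -, -, -, -⟩ := box hb
  have hpb : (p : ℤ) ≤ b 0 := by linarith
  have hdeg : (p : ℤ) * ((10 : ℕ) - 4 : ℤ) ≤ 2 * dOf b + 1 := by push_cast; linarith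
  rcases Int.emod_two_eq_zero_or_one (b 0) with hr | hr
  · exact cover_L5 hb hbj hj1 hj7 hprime hp5 hpb hwin (cover_ev hb hs hP hQ hF1 hF2 hp5 hp2 hr) (M := 10) (by norm_num) (by decide)
      (T := [1, -6, -6, 1]) (by decide) (by rw [oddFlag_false hr]; exact checkL5_ev) hdeg (by norm_num) hcas
  · exact cover_L5 hb hbj hj1 hj7 hprime hp5 hpb hwin (cover_od hb hs hP hQ hF1 hF2 hp5 hp2 hr) (M := 10) (by norm_num) (by decide)
      (T := [1, -6, -6, 1]) (by decide) (by rw [oddFlag_true hr]; exact checkL5_od) hdeg (by norm_num) hcas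

end Bounds

/-! ## §3 PATH accounting on the full profile, every sorted `b` -/

/-- **`PathAccountingFirstPeriod`'s conclusion on the FULL PROFILE of the first period for EVERY sorted `b`, every direction `j`**: for `b` sorted in
the polytope with `b + e_j` in the polytope, a prime `p ≥ 5` with `b₀ + 2 < p²` in the first period at which the least parameter `b₇` and the least
pair block `b₀ − b₁ − b₂` reach `p` (so all 28 forms lie in `[p, 2p)`: `N_p = 21`), and `d(b) < 4p`:
`⌊d/p⌋ − N_p − min([⌊d/p⌋ ≥ 2], 5 − C⋆) ≤ v_p(Cas_j(b))`. -/
theorem pathAccounting_fullProfile (b : ℕ → ℤ) (j p : ℕ) (hb : InPolytope b) (hs : Sorted7 b) (hbj : InPolytope (shift b j))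
    (hj1 : 1 ≤ j) (hj7 : j ≤ 7) (hprime : p.Prime) (hp5 : 5 ≤ p) (hwin : (b 0 + 2 : ℤ) < (p : ℤ) ^ 2) (hfp : FirstPeriod b p)
    (hP : (p : ℤ) ≤ b 7) (hQ : (p : ℤ) + b 1 + b 2 ≤ b 0) (hd4 : dOf b < 4 * (p : ℤ)) (hcas : casoratian b j ≠ 0) :
    dOf b / (p : ℤ) - pairFloors b p - min (if 2 ≤ dOf b / (p : ℤ) then (1 : ℤ) else 0) (5 - (cStar b p : ℤ))
      ≤ padicValRat p (casoratian b j) := by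
  obtain ⟨hF1, hF2⟩ := fp_bounds hfp
  have hp0 : (0 : ℤ) < p := by exact_mod_cast hprime.pos
  rw [pairFloors_eq_21 hs hprime.pos (by linarith) hfp]
  have hC11 : (cStar b p : ℤ) ≤ 11 := by exact_mod_cast cStar_le_eleven b p
  have hmin : -6 ≤ min (if 2 ≤ dOf b / (p : ℤ) then (1 : ℤ) else 0) (5 - (cStar b p : ℤ)) :=
    le_min (by split_ifs <;> norm_num) (by linarith)
  by_cases h3 : 3 * (p : ℤ) ≤ dOf b
  · have hfd : dOf b / (p : ℤ) < 4 := by rw [Int.ediv_lt_iff_lt_mul hp0]; linarith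
    linarith [cas_ge_neg12 hb hs hbj hj1 hj7 hprime hp5 hwin hP hQ hF1 hF2 h3 hcas]
  · push Not at h3
    have hfd : dOf b / (p : ℤ) < 3 := by rw [Int.ediv_lt_iff_lt_mul hp0]; linarith
    linarith [cas_ge_neg13 hb hs hbj hj1 hj7 hprime hp5 hwin hP hQ hF1 hF2 hcas]

/-- **THE NODE ON THE FULL PROFILE, EVERY SORTED `b`: `PathAccountingFirstPeriod` with its binders VERBATIM plus three hypotheses** — `p ≤ b₇` and
`p + b₁ + b₂ ≤ b₀` (all 28 forms reach `p`: the full profile) and `d(b) < 4p`.  Brown–Zudilin's prime-by-prime accounting (28)+(30), Casoratian form, on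
the deep end of the first period of EVERY direction of the polytope (sorted labelling), with no ray or family parametrisation. -/
theorem pathAccountingFirstPeriod_fullProfile :
    ∀ (b : ℕ → ℤ) (p : ℕ), InPolytope b → Sorted7 b → InPolytope (shift b 7) →
      p.Prime → 5 ≤ p → (b 0 + 2 : ℤ) < (p : ℤ) ^ 2 → FirstPeriod b p →
      (p : ℤ) ≤ b 7 → (p : ℤ) + b 1 + b 2 ≤ b 0 → dOf b < 4 * (p : ℤ) → casoratian b 7 ≠ 0 →
        dOf b / (p : ℤ) - pairFloors b p - min (if 2 ≤ dOf b / (p : ℤ) then (1 : ℤ) else 0) (5 - (cStar b p : ℤ))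
          ≤ padicValRat p (casoratian b 7) :=
  fun b p hb hs hb7 hprime hp5 hwin hfp hP hQ hd4 hcas =>
    pathAccounting_fullProfile b 7 p hb hs hb7 (by norm_num) (by norm_num) hprime hp5 hwin hfp hP hQ hd4 hcas

/-- **(CV) on the full profile, every sorted `b`, every `j`** (the (CV) value `refund − N_p` never exceeds the PATH value). -/
theorem fullProfileCV (b : ℕ → ℤ) (j p : ℕ) (hb : InPolytope b) (hs : Sorted7 b) (hbj : InPolytope (shift b j))
    (hj1 : 1 ≤ j) (hj7 : j ≤ 7) (hprime : p.Prime) (hp5 : 5 ≤ p) (hwin : (b 0 + 2 : ℤ) < (p : ℤ) ^ 2) (hfp : FirstPeriod b p)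
    (hP : (p : ℤ) ≤ b 7) (hQ : (p : ℤ) + b 1 + b 2 ≤ b 0) (hd4 : dOf b < 4 * (p : ℤ)) (hcas : casoratian b j ≠ 0) :
    refund b p - pairFloors b p ≤ padicValRat p (casoratian b j) := by
  linarith [refund_le_pathHead b p (5 - (cStar b p : ℤ)),
    pathAccounting_fullProfile b j p hb hs hbj hj1 hj7 hprime hp5 hwin hfp hP hQ hd4 hcas]

end Summit.KontsevichZagierPeriods.Zeta5Search.FullProfile
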